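import Literature.Claims.NS.Magsanop2026
import Literature.Barriers.NavierStokesRegularity.ScalingAudit
import Literature.Analysis.FluidPDE.CurlFreeLiouville
import Literature.Analysis.FluidPDE.KNSSLemma31Caloric
import Literature.Analysis.FluidPDE.VorticityCalculus
import Summits.NavierStokesRegularity.NavierStokesRegularity.Theorems.SoloRefuteMagsanop2026GN
import Summits.NavierStokesRegularity.NavierStokesRegularity.Theorems.SoloRefuteRamm2024
import Summits.NavierStokesRegularity.NavierStokesRegularity.Theorems.TypeILiouvilleTypeIliouvilleNoTypeIIStubThreeFifthsLawCurl
import Mathlib.MeasureTheory.Measure.Haar.NormedSpace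
import HarnessLib

/-!
# C145 `Magsanop2026` — records-grade kernel object: `¬ Step_lapVort` by the SCALING AUDIT

`Literature.Claims.NS.Magsanop2026.Step_lapVort` types p.3 l.75 «Since ‖Δω‖_{L²} ≤ C‖Δu‖_{L²}»
(`ω = curl u`) as ONE absolute constant `C` with `∫‖Δ(curl v)‖² ≤ C · ∫‖Δv‖²` for every smooth compactly
supported field `v` on `ℝ³`. The left side carries one more derivative: under the spatial dilations
`v ↦ v(λ·)` (`λ > 0`) one has `curl (v(λ·)) = λ · (curl v)(λ·)`, so `∫‖Δ(curl(v(λ·)))‖² = λ³ · ∫‖Δ(curl v)‖²`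
(degree `3`) while `∫‖Δ(v(λ·))‖² = λ · ∫‖Δv‖²` (degree `1`), and the catalogued barrier
`Literature.Barriers.NavierStokesRegularity.ScalingAudit.not_exists_forall_le_of_exponent_ne`
[cite: Tao2007WhyNSHard, supercriticality paragraph] refutes the display on the dilation-invariant class of
test fields — PROVIDED one test field has `∫‖Δ(curl v)‖² > 0`. That witness is the landed compactly
supported smooth divergence-free field `Theorems.Ramm2024.testDatum ≠ 0`, by a Liouville argument:
if `Δ(curl v) ≡ 0` then every coordinate of the compactly supported field `curl v` is a bounded harmonic
function, hence constant (`InnerProductSpace.HarmonicOnNhd.apply_eq_apply_of_abs_le`), hence `curl v ≡ 0`;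
a bounded `C²` field with `curl v = 0`, `div v = 0` is constant
(`Literature.Analysis.FluidPDE.eq_of_curl_eq_zero_of_isDivFree_of_bounded`, KNSS 2009 Lemma 3.1), and a
compactly supported constant field is `0`.

Main results (namespace `Summit.NavierStokesRegularity.NavierStokesRegularity.Theorems.Magsanop2026`,
the C145 kit's; all names new; the dilation lemmas `lapSq_comp_smul`, `isTestField_comp_smul` are imported
from the landed companion `Theorems.SoloRefuteMagsanop2026GN`, and `curl (v(c·)) x = c • (curl v)(c x)` is the
landed `Theorems.TypeIliouvilleNoTypeII.GradientPivot.curl_comp_smul`):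
* `lapSq_const_smul` — `lapSq (a • w) = a² · lapSq w`;
* `lapSq_curl_comp_smul` — `lapSq (curl (v(c·))) = c³ · lapSq (curl v)` for `c > 0`;
* `lapSq_curl_pos` — `0 < lapSq (curl v)` for every nonzero divergence-free test field;
* `not_Step_lapVort : ¬ Literature.Claims.NS.Magsanop2026.Step_lapVort`.

WHAT THIS IS NOT: not a claim about NS regularity or blow-up; not a claim about any author beyond the
typed locator [cite: Magsanop2026, §3 p.3 l.75]. `Step_lapVort` is binder `hLV` of the PROVED compositions
`claim_of_steps` / `claim_of_printed_steps` of the skeleton, downstream of the head; this object is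
records-grade (no head, no class change).
-/

set_option linter.dupNamespace false

open MeasureTheory Set Function
open scoped ContDiff Laplacian

namespace Summit.NavierStokesRegularity.NavierStokesRegularity.Theorems.Magsanop2026

open Literature.Analysis.FluidPDE Literature.Claims.NS.Magsanop2026
open Summit.NavierStokesRegularity.NavierStokesRegularity.Theorems.Ramm2024 (testDatum contDiff_testDatum
  hasCompactSupport_testDatum isDivFree_testDatum testDatum_ne_zero)
open Summit.NavierStokesRegularity.NavierStokesRegularity.Theorems.TypeIliouvilleNoTypeII.GradientPivot (curl_comp_smul)

/-! ## Amplitude, curl and dilation -/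

/-- **`‖Δ·‖²_{L²}` under amplitude scaling**: `lapSq (y ↦ a • w y) = a² · lapSq w` for `C²` fields
(Mathlib `InnerProductSpace.laplacian_smul`). [folklore] -/
theorem lapSq_const_smul {w : E3 → E3} (hw : ContDiff ℝ 2 w) (a : ℝ) :
    lapSq (fun y => a • w y) = a ^ 2 * lapSq w := by
  unfold lapSq
  have h : ∀ x, (Δ (fun y => a • w y)) x = a • (Δ w) x := fun x => by
    have := InnerProductSpace.laplacian_smul (f := w) (x := x) a hw.contDiffAt
    simpa [Pi.smul_def] using this
  simp_rw [h, norm_smul, mul_pow, integral_const_mul, Real.norm_eq_abs, sq_abs]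

/-- **`‖Δ curl ·‖²_{L²}` under dilation**: `lapSq (curl (y ↦ v (c • y))) = c³ · lapSq (curl v)` for `c > 0`
and smooth `v` (one factor `c²` from the landed `GradientPivot.curl_comp_smul`, one factor `c` from the change of
variables against the `c⁴` of the Laplacian). [folklore] -/
theorem lapSq_curl_comp_smul {v : E3 → E3} (hv : ContDiff ℝ ∞ v) {c : ℝ} (hc : 0 < c) :
    lapSq (curl (fun y => v (c • y))) = c ^ 3 * lapSq (curl v) := by
  have hcurl2 : ContDiff ℝ 2 (curl v) := contDiff_curl (n := 2) (hv.of_le (by norm_cast))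
  have h1 : curl (fun y => v (c • y)) = fun x => c • (fun z => curl v (c • z)) x := by
    funext x
    exact curl_comp_smul v c x
  rw [h1, lapSq_const_smul (w := fun z => curl v (c • z)) (hcurl2.comp (contDiff_id.const_smul c)) c,
    lapSq_comp_smul hcurl2 hc]
  ring

/-! ## The witness: `Δ (curl v) ≢ 0` for a nonzero divergence-free test field -/

/-- The Laplacian of a compactly supported field is compactly supported. [folklore] -/
theorem hasCompactSupport_laplacian_field {g : E3 → E3} (hg : HasCompactSupport g) :
    HasCompactSupport (Δ g) :=
  hg.mono' fun x hx => by
    by_contra h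
    exact hx (laplacian_eq_zero_of_notMem_tsupport h)

/-- **Liouville step**: a smooth compactly supported field on `ℝ³` whose Laplacian vanishes identically is
zero (each coordinate is a bounded harmonic function, hence constant —
`InnerProductSpace.HarmonicOnNhd.apply_eq_apply_of_abs_le` — and it vanishes off the compact support).
[folklore] -/
theorem eq_zero_of_hasCompactSupport_of_laplacian_eq_zero {g : E3 → E3} (hg : ContDiff ℝ 2 g)
    (hgc : HasCompactSupport g) (hΔ : ∀ x, (Δ g) x = 0) : g = 0 := by
  obtain ⟨M, hM⟩ := hg.continuous.bounded_above_of_compact_support hgc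
  have hconst : ∀ x y, g x = g y := fun x y => by
    ext i
    set η : E3 → ℝ := fun z => g z i with hη
    have hηeq : η = (EuclideanSpace.proj i : E3 →L[ℝ] ℝ) ∘ g := by
      funext z
      rfl
    have hη2 : ContDiff ℝ 2 η := by
      rw [hηeq]
      exact (EuclideanSpace.proj i : E3 →L[ℝ] ℝ).contDiff.comp hg
    have hηΔ : ∀ z, (Δ η) z = 0 := fun z => by
      rw [hηeq, hg.contDiffAt.laplacian_CLM_comp_left, Function.comp_apply, hΔ z, map_zero]
    have hharm := harmonicOnNhd_of_laplacian_eq_zero hη2 hηΔ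
    have hbdd : ∀ z, |η z| ≤ M := fun z =>
      le_trans (by simpa [hη, Real.norm_eq_abs] using PiLp.norm_apply_le (g z) i) (hM z)
    exact hharm.apply_eq_apply_of_abs_le hbdd x y
  obtain ⟨y₀, hy₀⟩ := (Set.ne_univ_iff_exists_notMem _).mp (IsCompact.ne_univ hgc)
  funext x
  exact (hconst x y₀).trans (image_eq_zero_of_notMem_tsupport hy₀)

/-- **The witness inequality**: for a nonzero divergence-free test field `v` on `ℝ³`,
`0 < lapSq (curl v) = ∫‖Δ(curl v)‖²`. If the integral vanished, the continuous compactly supported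
integrand would vanish identically, so `Δ(curl v) ≡ 0`, so `curl v ≡ 0`
(`eq_zero_of_hasCompactSupport_of_laplacian_eq_zero`), so the bounded field `v` with `curl v = 0`,
`div v = 0` is constant (`eq_of_curl_eq_zero_of_isDivFree_of_bounded`, KNSS 2009 Lemma 3.1) and, being
compactly supported, zero. [folklore] -/
theorem lapSq_curl_pos {v : E3 → E3} (hv : IsTestField v) (hdiv : NSWave0.IsDivFree v) (hne : v ≠ 0) :
    0 < lapSq (curl v) := by
  have hv2 : ContDiff ℝ 2 v := hv.1.of_le (by norm_cast)
  have hg3 : ContDiff ℝ 3 (curl v) := contDiff_curl (n := 3) (hv.1.of_le (by norm_cast))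
  have hg2 : ContDiff ℝ 2 (curl v) := hg3.of_le (by norm_cast)
  have hgc : HasCompactSupport (curl v) := hasCompactSupport_curl hv.2
  have hΔcont : Continuous (Δ (curl v)) :=
    (contDiff_laplacian_of_contDiff_infty (contDiff_curl (n := ⊤) (by simpa using hv.1))).continuous
  have hΔsupp : HasCompactSupport (Δ (curl v)) := hasCompactSupport_laplacian_field hgc
  unfold lapSq
  by_contra hle
  have h0 : ∫ x, ‖(Δ (curl v)) x‖ ^ 2 = 0 :=
    le_antisymm (not_lt.mp hle) (integral_nonneg fun _ => by positivity)
  have hsupp2 : HasCompactSupport (fun x => ‖(Δ (curl v)) x‖ ^ 2) :=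
    hΔsupp.mono fun x hx => by simpa using hx
  have hint : Integrable (fun x => ‖(Δ (curl v)) x‖ ^ 2) :=
    (hΔcont.norm.pow 2).integrable_of_hasCompactSupport hsupp2
  have hae : (fun x => ‖(Δ (curl v)) x‖ ^ 2) =ᵐ[volume] 0 :=
    (integral_eq_zero_iff_of_nonneg (fun _ => by positivity) hint).mp h0
  have hzero : (fun x => ‖(Δ (curl v)) x‖ ^ 2) = 0 :=
    (Continuous.ae_eq_iff_eq volume (hΔcont.norm.pow 2) continuous_const).mp hae
  have hΔ0 : ∀ x, (Δ (curl v)) x = 0 := fun x => by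
    have := congr_fun hzero x
    simpa using this
  have hcurl0 : ∀ x, curl v x = 0 := fun x => by
    rw [eq_zero_of_hasCompactSupport_of_laplacian_eq_zero hg2 hgc hΔ0]
    rfl
  obtain ⟨M, hM⟩ := hv.1.continuous.bounded_above_of_compact_support hv.2
  have hvconst := eq_of_curl_eq_zero_of_isDivFree_of_bounded hv2 hcurl0 (fun x => hdiv x) hM
  obtain ⟨y₁, hy₁⟩ := (Set.ne_univ_iff_exists_notMem _).mp (IsCompact.ne_univ hv.2)
  exact hne (funext fun x => (hvconst x y₁).trans (image_eq_zero_of_notMem_tsupport hy₁))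

/-! ## The refutation -/

/-- **`Step_lapVort` is false as typed** (p.3 l.75 «‖Δω‖_{L²} ≤ C‖Δu‖_{L²}» with ONE absolute `C` on all
smooth compactly supported `u`): the catalogued SCALING AUDIT
`ScalingAudit.not_exists_forall_le_of_exponent_ne` on the dilation family `δ λ v = v(λ·)` acting on the
class of test fields — degrees `lapSq ∘ curl ↦ 3` (`lapSq_curl_comp_smul`), `lapSq ↦ 1`, `3 ≠ 1`; the witness
with positive left side is `Ramm2024.testDatum` (`lapSq_curl_pos`).
[cite: Magsanop2026, §3 p.3 l.75] [cite: Tao2007WhyNSHard, supercriticality paragraph] -/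
theorem not_Step_lapVort : ¬ Literature.Claims.NS.Magsanop2026.Step_lapVort := by
  rintro ⟨C, -, hC⟩
  have hT : IsTestField testDatum := ⟨contDiff_testDatum, hasCompactSupport_testDatum⟩
  have key := Literature.Barriers.NavierStokesRegularity.ScalingAudit.not_exists_forall_le_of_exponent_ne
    (X := E3 → E3) (δ := fun l w => fun y => w (l • y)) (S := {w | IsTestField w})
    (F := fun w => lapSq (curl w)) (G := lapSq) (s := 3) (r := 1) (u₀ := testDatum)
    (fun l hl u hu => isTestField_comp_smul hu hl.ne')
    (fun l hl u hu => by
      rw [lapSq_curl_comp_smul hu.1 hl, Real.rpow_ofNat])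
    (fun l hl u hu => by
      rw [lapSq_comp_smul (hu.1.of_le (by norm_cast)) hl, Real.rpow_one])
    (by norm_num) hT (lapSq_curl_pos hT isDivFree_testDatum testDatum_ne_zero)
  exact key ⟨C, fun u hu => hC u hu⟩

end Summit.NavierStokesRegularity.NavierStokesRegularity.Theorems.Magsanop2026
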